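import Summits.KontsevichZagierPeriods.KontsevichZagierPeriods.Statement
import Summits.KontsevichZagierPeriods.KontsevichZagierPeriods.Theses.FermatIsogeny
import Summits.KontsevichZagierPeriods.KontsevichZagierPeriods.Theorems.FermatIsogenyBetaLinearSectorQuarters
import Summits.KontsevichZagierPeriods.KontsevichZagierPeriods.Theorems.GammaHodgeSector.Negative.LoadBearing

/-!
# Rung line `ProdRungFour` of crux `BetaProductSector` (stmt-KontsevichZagierPeriods-3898) — SPECIAL FILE:
# the proved FLOOR witness and the logical position of the rung (sorry-free, self-contained)

Companion of `Lines/ProdRungFour.lean` (forward-harvest, planner-fwd-harvest-KontsevichZagierPeriods-3898-0,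
2026-08-17; source seat planner-fwd-ladder-KontsevichZagierPeriods-3898-0, whose typed ladder is published verbatim as
`Cruxes/BetaProductSector/Ladder.lean`, commit 94826a4f5b05).  Like the skeleton, this file carries VERBATIM COPIES of the
ladder's `LinRung` / `ProdRung` instead of importing the `Ladder` module (self-contained convention of this crux directory;
the identifications with `Ladder.LinRung 4` / `Ladder.ProdRung 4` are `Iff.rfl`, `Lines/ProdRungFour_ladder.lean`).

* WITNESS (F3 of the forward fit): the dimension-1 FLOOR of the rung at the same level, `LinRung 4` = crux 3
  `BetaLinearSector` on the quarter-integer sector, UNCONDITIONAL — the landed `Quarters.betaLinearSector_quarters`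
  (p156804, `--supports stmt-KontsevichZagierPeriods-3897`; Euler reflection at `¼`, Legendre duplication, Chudnovsky
  `π ⟂ Γ(¼)`), BY NAME.  The rung `ProdRung 4` (dimension 2 at level 4) lies OUTSIDE the summit's known regime: no
  two-dimensional Beta-product instance family of Conjecture 1 beyond `β(1,1)`-padding of the linear sector is a theorem
  in the tree or in print (source dossier `LADDER-BetaProductSector.md` §2, §6).
* ON-PATH (F4): the crux gives the rung (`prodRung_four_of_crux`), and so does the summit (`prodRung_four_of_summit`, via
  the landed `GammaHodgeSectorNegative.core_of_summit`); the rung does NOT give the crux or the summit back (source probes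
  `bc/probes.txt`: `exact? / simpa / unfold; simpa / aesop` FAIL 4/4), and the limit of the level ladder is the crux itself
  (`Ladder.betaProductSector_iff_forall_prodRung`).
* NEXT GAPS: `ProdRung 8 → ProdRung 4`, `ProdRung 12 → ProdRung 4` (`prodRung_four_of_mul`).
References: Kontsevich–Zagier 2001 §1.2; Chudnovsky 1984 Ch. 7 §2 Cor. 2.3.
-/

set_option linter.dupNamespace false

namespace Summit.KontsevichZagierPeriods.KontsevichZagierPeriods.Cruxes.BetaProductSector.ProdRungFour.Special

open Literature.NumberTheory.Transcendental
open Summit.KontsevichZagierPeriods.KontsevichZagierPeriods.Theses.FermatIsogeny (BetaProductSector)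

/-! ## Verbatim copies of the ladder's rung predicates (`Cruxes/BetaProductSector/Ladder.lean`) -/

/-- `LinRung N` — VERBATIM COPY of `…Cruxes.BetaProductSector.Ladder.LinRung`: crux 3 `BetaLinearSector` with the four
exponents in `(1/N)ℤ`. [cite: KontsevichZagier2001, §1.2] -/
def LinRung (N : ℕ) : Prop :=
  ∀ (a b a' b' : ℚ) (c : ℝ), 0 < a → 0 < b → 0 < a' → 0 < b' → IsAlgebraic ℚ c →
    (∃ m : ℤ, a = m / N) → (∃ m : ℤ, b = m / N) → (∃ m : ℤ, a' = m / N) → (∃ m : ℤ, b' = m / N) →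
    ∀ (r r' : KZ.IntegralRep 1), r.domain = {x | x 0 ∈ Set.Ioo (0:ℝ) 1} →
    Set.EqOn r.integrand (fun x => (x 0) ^ ((a:ℝ) - 1) * (1 - x 0) ^ ((b:ℝ) - 1)) r.domain →
    r'.domain = {x | x 0 ∈ Set.Ioo (0:ℝ) 1} →
    Set.EqOn r'.integrand (fun x => c * (x 0) ^ ((a':ℝ) - 1) * (1 - x 0) ^ ((b':ℝ) - 1)) r'.domain →
    r.value = r'.value → KZ.Equivalent r r'

/-- `ProdRung N` — VERBATIM COPY of `…Cruxes.BetaProductSector.Ladder.ProdRung` (identical to the copy in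
`Lines/ProdRungFour.lean`): the crux `BetaProductSector` with the eight exponents in `(1/N)ℤ`.
[cite: KontsevichZagier2001, §1.2] -/
def ProdRung (N : ℕ) : Prop :=
  ∀ (a b e d a' b' e' d' : ℚ) (q : ℝ), 0 < a → 0 < b → 0 < e → 0 < d → 0 < a' → 0 < b' → 0 < e' → 0 < d' →
    IsAlgebraic ℚ q →
    (∃ m : ℤ, a = m / N) → (∃ m : ℤ, b = m / N) → (∃ m : ℤ, e = m / N) → (∃ m : ℤ, d = m / N) →
    (∃ m : ℤ, a' = m / N) → (∃ m : ℤ, b' = m / N) → (∃ m : ℤ, e' = m / N) → (∃ m : ℤ, d' = m / N) →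
    ∀ (r r' : KZ.IntegralRep 2), r.domain = {x | ∀ i, x i ∈ Set.Ioo (0:ℝ) 1} →
    Set.EqOn r.integrand (fun x => (x 0) ^ ((a:ℝ) - 1) * (1 - x 0) ^ ((b:ℝ) - 1) * (x 1) ^ ((e:ℝ) - 1) *
      (1 - x 1) ^ ((d:ℝ) - 1)) r.domain →
    r'.domain = {x | ∀ i, x i ∈ Set.Ioo (0:ℝ) 1} →
    Set.EqOn r'.integrand (fun x => q * (x 0) ^ ((a':ℝ) - 1) * (1 - x 0) ^ ((b':ℝ) - 1) * (x 1) ^ ((e':ℝ) - 1) *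
      (1 - x 1) ^ ((d':ℝ) - 1)) r'.domain →
    r.value = r'.value → KZ.Equivalent r r'

/-! ## The witness: the proved floor `LinRung 4` -/

/-- **WITNESS — the floor of the rung**: Conjecture 1 for Beta integrals with quarter-integer exponents (dimension 1,
level 4), unconditionally: the landed anchor `Quarters.betaLinearSector_quarters` (p156804), by name (this is the
ladder's `linRung_four`, same proof term). [cite: KontsevichZagier2001, §1.2] [cite: Chudnovsky1984, Ch. 7 §2 Cor. 2.3] -/
theorem witness_linRung_four : LinRung 4 :=
  fun a b a' b' c ha hb ha' hb' hc h₁ h₂ h₃ h₄ =>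
    Summit.KontsevichZagierPeriods.FermatIsogeny.BetaLinearSector.Quarters.betaLinearSector_quarters
      a b a' b' c ha hb ha' hb' hc (by simpa using h₁) (by simpa using h₂) (by simpa using h₃) (by simpa using h₄)

/-! ## The position of the rung -/

/-- ON-PATH: the crux `BetaProductSector` gives every level rung, in particular `ProdRung 4` (forget the level
hypotheses; the ladder's `prodRung_of_betaProductSector`). [cite: KontsevichZagier2001, §1.2] -/
theorem prodRung_of_crux (h : BetaProductSector) (N : ℕ) : ProdRung N :=
  fun a b e d a' b' e' d' q ha hb he hd ha' hb' he' hd' hq _ _ _ _ _ _ _ _ =>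
    h a b e d a' b' e' d' q ha hb he hd ha' hb' he' hd' hq

/-- ON-PATH: the crux gives the rung `ProdRung 4`. [cite: KontsevichZagier2001, §1.2] -/
theorem prodRung_four_of_crux (h : BetaProductSector) : ProdRung 4 :=
  prodRung_of_crux h 4

/-- ON-PATH: the summit gives the rung `ProdRung 4` (through the landed `core_of_summit`: the summit decides every pair
of representations with equal values). [cite: KontsevichZagier2001, §1.2] -/
theorem prodRung_four_of_summit (h : _root_.KontsevichZagierPeriods) : ProdRung 4 :=
  fun _ _ _ _ _ _ _ _ _ _ _ _ _ _ _ _ _ _ _ _ _ _ _ _ _ _ ρ ρ' _ _ _ _ hv =>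
    Summit.KontsevichZagierPeriods.GammaHodgeSectorNegative.core_of_summit h ρ ρ' hv

/-- Scaling a level witness: `x = m/N` gives `x = (m k)/(N k)`. [folklore] -/
theorem exists_eq_div_mul {x : ℚ} {N k : ℕ} (hk : k ≠ 0) (h : ∃ m : ℤ, x = m / N) :
    ∃ m : ℤ, x = m / ((N * k : ℕ) : ℚ) := by
  obtain ⟨m, hm⟩ := h
  have hk0 : (k : ℚ) ≠ 0 := by exact_mod_cast hk
  refine ⟨m * k, ?_⟩
  push_cast
  rw [mul_div_mul_right _ _ hk0]
  exact hm

/-- LEVEL MONOTONICITY at the rung (the next gaps contain this one): `ProdRung (4 k) → ProdRung 4` for `k ≠ 0`, e.g.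
`ProdRung 8 → ProdRung 4`, `ProdRung 12 → ProdRung 4` (the ladder's `prodRung_of_dvd`). [folklore] -/
theorem prodRung_four_of_mul {k : ℕ} (hk : k ≠ 0) (h : ProdRung (4 * k)) : ProdRung 4 :=
  fun a b e d a' b' e' d' q ha hb he hd ha' hb' he' hd' hq h₁ h₂ h₃ h₄ h₅ h₆ h₇ h₈ =>
    h a b e d a' b' e' d' q ha hb he hd ha' hb' he' hd' hq (exists_eq_div_mul hk h₁) (exists_eq_div_mul hk h₂)
      (exists_eq_div_mul hk h₃) (exists_eq_div_mul hk h₄) (exists_eq_div_mul hk h₅) (exists_eq_div_mul hk h₆)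
      (exists_eq_div_mul hk h₇) (exists_eq_div_mul hk h₈)

/-- In particular `ProdRung 8 → ProdRung 4`. [folklore] -/
theorem prodRung_four_of_eight (h : ProdRung 8) : ProdRung 4 :=
  prodRung_four_of_mul (k := 2) two_ne_zero h

end Summit.KontsevichZagierPeriods.KontsevichZagierPeriods.Cruxes.BetaProductSector.ProdRungFour.Special
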